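import Mathlib.LinearAlgebra.BilinearForm.TensorProduct
import Mathlib.LinearAlgebra.BilinearForm.Properties
import Mathlib.LinearAlgebra.TensorProduct.Tower
import Mathlib.RingTheory.TensorProduct.Basic
import Mathlib.Analysis.Complex.Basic
import Mathlib.Algebra.Algebra.Rat
import Literature.NumberTheory.Kottwitz1992.FunctorialIsomorphisms
import Literature.AlgebraicGeometry.GaoUllmo2025.CMHodgeModel
import HarnessLib

/-!
# Kottwitz (1992), §13 — Polarized abelian varieties with CM (pp. 414–418): the definitions, the printed
# linear-algebra facts, and Lemmas 13.1–13.2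

Carpet file of squad TK (cell `hodgecm-mathlib`), source [Kottwitz1992] §13, printed pp. 414–418 (held text
`paper:doi-10-2307-2152772`, p0042–p0046).  STATEMENTS ONLY: named facts / named predicates `def … : Prop`,
interface definitions with bodies; no proof, no `sorry`, no `axiom`, no `instance`, no notation.

## The setting (pp. 414–415), and what is typed

«Let `F` be a CM-algebra, by which we mean a finite product of number fields, each of which is a totally complex
quadratic extension of a totally real field» — the tree's `Literature.AlgebraicGeometry.GaoUllmo2025.IsCMAlgebra`
(cited, not restated).  «Let `*` be the unique positive involution on `F`; on each factor of `F ⊗_ℚ ℝ ≅ ℂ × ⋯ × ℂ` it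
induces complex conjugation» — `IsCMInvolution F c` for `c : F ≃ₐ[ℚ] F`.  «We write `T` for the `ℚ`-torus
`{x ∈ F^× | x x* ∈ ℚ^×}`» — its points in a `ℚ`-algebra `R` are the units `x` of `F ⊗_ℚ R` with `x x* ∈ R^×`
(`IsTorusPoint`).  `K, ℚ_p, K^un, L, Γ, σ` as in §12 (`FunctorialIsomorphisms.IsLDatum`), `K` large enough that
there are `[F : ℚ]` distinct `ℚ`-algebra maps `F → K` (`T_{ℚ_p}` split by `K`); `S := Hom_{ℚ-alg}(F, K)` is a basis of
`X_*(R_{(F ⊗ ℚ_p)/ℚ_p} 𝔾_m)`; a CM type `S_A ⊂ S` («`*(S_A)` and `S_A` are disjoint and their union is `S`»,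
`IsCMTypeRel`) has `μ := Σ_{s ∈ S_A} s` (`muOf`), which lies in `X_*(T_{ℚ_p}) ⊂ ℤ[S]` (`cocharT`; printed claim,
typed as `Kottwitz1992_13_mu_mem_cocharT`).  «A symplectic space with CM by `F` over a field `E` of characteristic
`0` is a representation of `F` on an `E`-vector space `V` together with a nondegenerate alternating form `(·,·)` on
`V` such that `(xv, w) = (v, x*w)` … satisfying the further requirement that `V` be free of rank `1` as
`F ⊗_ℚ E`-module. By an isomorphism … we mean an `E`-linear isomorphism commuting with the action of `F` and
carrying the alternating form on `V₂` into a scalar multiple of the one on `V₁`» — `IsSymplecticCM`, `IsIsomCM`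
(the `F`-action as a unital ring homomorphism `F → Module.End E V`, given as a function).  «The isomorphism classes of symplectic spaces with
CM by `F` over `L` are classified by `H¹(L, T)`, and this group is trivial by a theorem of Steinberg [St]» ⟹ any two
are isomorphic — typed as `Kottwitz1992_13_symplecticCM_over_L_unique` (used again on p. 416).  The element
`b ∈ T(L)` attached to `(H, D, Φ)` («Choose an isomorphism … `H_L := H ⊗_{ℚ_p} L → D`, … transport `Φ` …, write
`Φ = bσ`, where `σ := id_H ⊗ σ`. Then `b` is an automorphism of the symplectic space `H_L` with CM by `F` and hence
defines an element `b ∈ T(L)`. Changing the choice of isomorphism `H_L ≅ D` does not change the image of `b` in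
`B(T_{ℚ_p})`») — `IsBOf` and the typed fact `Kottwitz1992_13_b_class_independent` (`σ`-conjugacy in `T(L)`).

## Lemmas 13.1 and 13.2 — named PREDICATES, and why

Lemma 13.1 («The image of `b` in `B(T_{ℚ_p})` is equal to the negative of the image of `μ ∈ X_*(T_{ℚ_p})` under the
canonical isomorphism `X_*(T_{ℚ_p})_Γ ≅ B(T_{ℚ_p})` of [K3]») is asserted for `(H, D, Φ, S_A)` = (the étale
`H_1(A_{ℚ̄_p}, ℚ_p)`, the isocrystal dual to `H¹_cris(A_k/W(k)) ⊗ L`, its Frobenius, the CM type of `Lie A`) of an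
abelian variety `A` over the `p`-adic field `K` with good reduction and CM by `F` (Néron model, geometric special
fibre), and is PROVED from Lemma 12.1 via Shimura–Taniyama [ST] and the comparison theorem of Fontaine–Messing and
Faltings [Fa] (pp. 415–416).  Lemma 13.2 («The character `α` on `T̂^Γ` is trivial») concerns `(A, F → End A, λ)` over
`𝔽̄_p` and the characters `α(v) ∈ X^*(π₀(T̂^{Γ(v)}))` at ALL places `v` of `ℚ` obtained from `H_1(A, ℚ_l)`
(`l ≠ p`, via `H¹(ℚ_l, T) ≅ X^*(π₀(T̂^{Γ(l)}))`), from `D` (via `B(T_{ℚ_p}) ≅ X^*(T̂^{Γ(p)})`) and from the polarization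
(`α(∞)`), and is proved from 13.1 via Tate's theorem [T3] (CM lifting) and Tate–Nakayama duality (pp. 416–418).
The provenance «arises from `(A, i, λ)`» (abelian varieties with CM over `p`-adic and finite fields, Néron models,
étale and crystalline `H_1`, local class field theory) has no Mathlib counterpart and is not expressible by the
linear-algebra data alone; over arbitrary data `(H, D, Φ, S_A)` resp. `(α(v))_v` the conclusions are false.
Hence the two lemmas are typed as NAMED PREDICATES on explicit data — `Kottwitz1992_13_1_statement` (the printed
identity `[b] = -f(μ)` in `B(T_{ℚ_p})`, `σ`-conjugacy form, with the [K3] map entered as a parameter) and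
`Kottwitz1992_13_2_statement` (in the lattice form `X^*(T̂^{Γ(v)}) = X_*(T)_{Γ(v)}`, `X^*(T̂^Γ) = X_*(T)_Γ`:
«the product over all places of the restrictions of `α(v)` to `T̂^Γ` is trivial» = the sum of the images of the
`α(v)` in `X_*(T)_Γ` vanishes) — which the paper proves for data arising from `(A, i, λ)`; downstream files take
them as hypotheses on their data.
-- TODO(general form): assert 13.1 / 13.2 as closed facts once abelian varieties with CM over `p`-adic / finite
-- fields with their étale and crystalline `H_1` (tree `Literature.AlgebraicGeometry.Motives.AbelianVariety`,
-- `CrystallineRealization`) are connected to this file's `(H, D, Φ, S_A)`.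

## References

* [Kottwitz1992] §13, pp. 414–418 (and §9 Lemmas 9.1–9.2, §4 Lemma 4.3, §12 Lemma 12.1, quoted by the proofs).
* [Kottwitz1985Isocrystals] §2 (= [K3]: `X_*(T)_Γ ≅ B(T)`, `B(T_{ℚ_p}) ≅ X^*(T̂^{Γ(p)})`).
-/

noncomputable section

open scoped TensorProduct
open WittVector

namespace Literature.NumberTheory.Kottwitz1992.CMPolarized

open Literature.NumberTheory.Kottwitz1992.FunctorialIsomorphisms

/-! ## CM-algebras with involution, the torus `T`, CM types (pp. 414–415) -/

section CMData

variable (F : Type) [CommRing F] [Algebra ℚ F]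

/-- «Let `*` be the unique positive involution on `F`; on each factor of `F ⊗_ℚ ℝ ≅ ℂ × ⋯ × ℂ` it induces complex
conjugation»: `c` is an involutive `ℚ`-algebra automorphism of the CM-algebra `F` such that every `ℚ`-algebra map
`F → ℂ` intertwines `c` with complex conjugation. [cite: Kottwitz1992, §13 (p. 414)] -/
def IsCMInvolution (c : F ≃ₐ[ℚ] F) : Prop :=
  (∀ x : F, c (c x) = x) ∧ ∀ (φ : F →ₐ[ℚ] ℂ) (x : F), φ (c x) = starRingEnd ℂ (φ x)

variable (c : F ≃ₐ[ℚ] F) (R : Type) [CommRing R] [Algebra ℚ R]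

/-- The `R`-points of «the `ℚ`-torus `T = {x ∈ F^× | x x* ∈ ℚ^×}`»: units `x` of `F ⊗_ℚ R` with `x · x* ∈ R^×`
(`*` acting through the factor `F`). [cite: Kottwitz1992, §13 (p. 414)] -/
def IsTorusPoint (x : (F ⊗[ℚ] R)ˣ) : Prop :=
  ∃ r : Rˣ, (x : F ⊗[ℚ] R) * Algebra.TensorProduct.map (c : F →ₐ[ℚ] F) (AlgHom.id ℚ R) x =
    (Algebra.TensorProduct.includeRight : R →ₐ[ℚ] F ⊗[ℚ] R) (r : R)

variable (K : Type) [Field K] [Algebra ℚ K]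

/-- «`K` is large enough that there are `[F : ℚ]` distinct `ℚ`-algebra maps `F → K`, so that in particular `T_{ℚ_p}`
is split by `K`»: there is an injective family of `[F : ℚ]` such maps. [cite: Kottwitz1992, §13 (p. 414)] -/
def SplitsOver : Prop :=
  ∃ s : Fin (Module.finrank ℚ F) → (F →ₐ[ℚ] K), Function.Injective s

/-- A CM type of `F` relative to `K` (p. 415: for the CM type `S_A ⊂ S = Hom_{ℚ-alg}(F, K)` of `A`, «`*(S_A)` and
`S_A` are disjoint and their union is `S`»): for every `s ∈ S` exactly one of `s`, `s ∘ *` lies in `S_A`.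
[cite: Kottwitz1992, §13 (p. 415)] -/
def IsCMTypeRel (SA : Finset (F →ₐ[ℚ] K)) : Prop :=
  ∀ s : F →ₐ[ℚ] K, s ∈ SA ↔ s.comp (c : F →ₐ[ℚ] F) ∉ SA

/-- «the cocharacter `μ := Σ_{s ∈ S_A} s` of `R_{(F ⊗_ℚ ℚ_p)/ℚ_p} 𝔾_m`», in `X_*(R_{(F⊗ℚ_p)/ℚ_p}𝔾_m) = ℤ[S]` («free with
basis `S := Hom_{ℚ-alg}(F, K)`», p. 414). [cite: Kottwitz1992, §13 (p. 415)] -/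
def muOf (SA : Finset (F →ₐ[ℚ] K)) : (F →ₐ[ℚ] K) →₀ ℤ :=
  SA.sum fun s => Finsupp.single s 1

/-- `X_*(T_{ℚ_p}) ⊂ X_*(R_{(F⊗ℚ_p)/ℚ_p}𝔾_m) = ℤ[S]`: the cocharacters `y = Σ n_s s` of the torus `T = {x | x x* ∈ 𝔾_m}`,
i.e. those with `n_s + n_{s∘*}` independent of `s`. [cite: Kottwitz1992, §13 (p. 415)] -/
def cocharT : Submodule ℤ ((F →ₐ[ℚ] K) →₀ ℤ) :=
  ⨅ s : F →ₐ[ℚ] K, ⨅ t : F →ₐ[ℚ] K,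
    LinearMap.ker
      (Finsupp.lapply s + Finsupp.lapply (s.comp (c : F →ₐ[ℚ] F)) -
        Finsupp.lapply t - Finsupp.lapply (t.comp (c : F →ₐ[ℚ] F)) : ((F →ₐ[ℚ] K) →₀ ℤ) →ₗ[ℤ] ℤ)

/-- Printed claim (p. 415): «Thus the cocharacter `μ := Σ_{s ∈ S_A} s` of `R_{(F⊗ℚ_p)/ℚ_p}𝔾_m` belongs to the subgroup
`X_*(T_{ℚ_p})`» — for every CM type `S_A` relative to `K`. [cite: Kottwitz1992, §13 (p. 415)] -/
def Kottwitz1992_13_mu_mem_cocharT : Prop :=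
  ∀ SA : Finset (F →ₐ[ℚ] K), IsCMTypeRel F c K SA → muOf F K SA ∈ cocharT F c K

end CMData

/-! ## Symplectic spaces with CM by `F` (p. 415) -/

section Symplectic

variable (F : Type) [CommRing F] [Algebra ℚ F] (c : F ≃ₐ[ℚ] F)
variable (E : Type) [Field E]
variable (V : Type) [AddCommGroup V] [Module E V] (i : F → Module.End E V) (ω : LinearMap.BilinForm E V)

/-- «A symplectic space with CM by `F` over a field `E` of characteristic `0` is a representation of `F` on an
`E`-vector space `V` (here a unital ring homomorphism `i : F → End_E(V)`, given as a function with the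
homomorphism property part of the predicate) together with a nondegenerate alternating form `(·,·)` on `V` such
that `(xv, w) = (v, x*w)` for all `x ∈ F` and all `v, w ∈ V`, satisfying the further requirement that `V` be free of
rank `1` as `F ⊗_ℚ E`-module» (free of rank one ⟺ cyclic for `F ⊗ E` and `dim_E V = [F : ℚ]`).
[cite: Kottwitz1992, §13 (p. 415)] -/
def IsSymplecticCM : Prop :=
  (i 1 = 1 ∧ ∀ x y : F, i (x + y) = i x + i y ∧ i (x * y) = i x * i y) ∧
    ω.IsAlt ∧ ω.Nondegenerate ∧ (∀ (x : F) (v w : V), ω (i x v) w = ω v (i (c x) w)) ∧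
    Module.finrank E V = Module.finrank ℚ F ∧
    ∃ v₀ : V, Submodule.span E (Set.range fun x : F => i x v₀) = ⊤

variable (V' : Type) [AddCommGroup V'] [Module E V'] (i' : F → Module.End E V') (ω' : LinearMap.BilinForm E V')

/-- «By an isomorphism `f : V₁ → V₂` between two such objects we mean an `E`-linear isomorphism `f` commuting with the
action of `F` and carrying the alternating form on `V₂` into a scalar multiple of the one on `V₁` (here scalar means
an element of `E^×`).» [cite: Kottwitz1992, §13 (p. 415)] -/
def IsIsomCM (f : V ≃ₗ[E] V') : Prop :=
  (∀ (x : F) (v : V), f (i x v) = i' x (f v)) ∧ ∃ a : E, a ≠ 0 ∧ ∀ v w : V, ω' (f v) (f w) = a * ω v w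

/-- «The torus `T` is the group of automorphisms of `V`» (p. 416): an `E`-linear automorphism of `V` commuting with
`F` and scaling the form by a unit — an element of `T(E)` realised on the symplectic CM space `V`.
[cite: Kottwitz1992, §13 (p. 416)] -/
def IsAutCM (t : V ≃ₗ[E] V) : Prop :=
  IsIsomCM F E V i ω V i ω t

end Symplectic

/-! ## Over `L`: uniqueness, the element `b`, and Lemma 13.1 (pp. 415–416) -/

section OverL

variable (p : ℕ) [Fact p.Prime] (k : Type) [Field k] [CharP k p] [IsAlgClosed k]
variable (Q : Type) [Field Q] (L : Type) [Field L] [Algebra Q L] (σ : L ≃ₐ[Q] L) (eL : L ≃+* FractionRing (WittVector p k))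
variable (F : Type) [CommRing F] [Algebra ℚ F] (c : F ≃ₐ[ℚ] F)

/-- Printed claim (p. 415, used again p. 416): «The isomorphism classes of symplectic spaces with CM by `F` over `L`
are classified by `H¹(L, T)`, and this group is trivial by a theorem of Steinberg [St]» ⟹ any two symplectic spaces
with CM by `F` over `L` (`L` the completion of the maximal unramified extension of `ℚ_p`, `IsLDatum`) are isomorphic.
[cite: Kottwitz1992, §13 (p. 415)] -/
def Kottwitz1992_13_symplecticCM_over_L_unique : Prop :=
  IsLDatum p k Q L σ eL → Literature.AlgebraicGeometry.GaoUllmo2025.IsCMAlgebra F → IsCMInvolution F c →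
    ∀ (D : Type) [AddCommGroup D] [Module L D] (i : F → Module.End L D) (ω : LinearMap.BilinForm L D)
      (D' : Type) [AddCommGroup D'] [Module L D'] (i' : F → Module.End L D') (ω' : LinearMap.BilinForm L D'),
      IsSymplecticCM F c L D i ω → IsSymplecticCM F c L D' i' ω' → ∃ f : D ≃ₗ[L] D', IsIsomCM F L D i ω D' i' ω' f

variable (H : Type) [AddCommGroup H] [Module Q H] (iH : F → Module.End Q H) (ωH : LinearMap.BilinForm Q H)
variable (D : Type) [AddCommGroup D] [Module L D] (iD : F → Module.End L D) (ωD : LinearMap.BilinForm L D)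
  (ΦD : D →ₛₗ[σ.toAlgHom.toRingHom] D)

/-- The `F`-action on `H_L := L ⊗_{ℚ_p} H` induced from the one on `H` (base change of each `i x`).
[cite: Kottwitz1992, §13 (p. 415)] -/
def actL (x : F) : Module.End L (L ⊗[Q] H) :=
  (iH x).baseChange L

/-- `σ := id_H ⊗ σ` on `H_L = L ⊗_{ℚ_p} H` (p. 415, «where `σ := id_H ⊗ σ`»), as a `ℚ_p`-linear map.
[cite: Kottwitz1992, §13 (p. 415)] -/
def sigmaHL : L ⊗[Q] H →ₗ[Q] L ⊗[Q] H :=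
  LinearMap.rTensor H σ.toLinearMap

/-- «Choose an isomorphism of symplectic spaces with CM by `F` from `H_L := H ⊗_{ℚ_p} L` to `D`, and use this to
transport the `σ`-linear operator `Φ` on `D` to a `σ`-linear bijection `Φ : H_L → H_L`. Write `Φ = bσ`, where
`σ := id_H ⊗ σ`. Then `b` is an automorphism of the symplectic space `H_L` with CM by `F` and hence defines an element
`b ∈ T(L)`.»  `IsBOf ψ b`: `ψ : H_L ≃ D` is such an isomorphism and `b` is the `L`-linear automorphism of `H_L` with
`ψ⁻¹ Φ ψ = b ∘ σ`. [cite: Kottwitz1992, §13 (p. 415)] -/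
def IsBOf (ψ : L ⊗[Q] H ≃ₗ[L] D) (b : L ⊗[Q] H ≃ₗ[L] L ⊗[Q] H) : Prop :=
  IsIsomCM F L (L ⊗[Q] H) (actL Q L F H iH) (ωH.baseChange L) D iD ωD ψ ∧
    ∀ v : L ⊗[Q] H, ψ.symm (ΦD (ψ v)) = b (sigmaHL Q L σ H v)

/-- `b, b' ∈ T(L)` (automorphisms of the symplectic CM space `H_L`) have the same image in
`B(T_{ℚ_p}) = T(L)/{t σ(t)⁻¹}`: `b' = t b σ(t)⁻¹` for some `t ∈ T(L)`, where `σ(t) = σ ∘ t ∘ σ⁻¹` on `H_L`; stated as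
`b' (σ t v) = t (b (σ v))` for all `v`. [cite: Kottwitz1992, §13 (p. 415)] [cite: Kottwitz1985Isocrystals, §2] -/
def SameBClass (b b' : L ⊗[Q] H ≃ₗ[L] L ⊗[Q] H) : Prop :=
  ∃ t : L ⊗[Q] H ≃ₗ[L] L ⊗[Q] H, IsAutCM F L (L ⊗[Q] H) (actL Q L F H iH) (ωH.baseChange L) t ∧
    ∀ v : L ⊗[Q] H, b' (sigmaHL Q L σ H (t v)) = t (b (sigmaHL Q L σ H v))

/-- Printed claim (p. 415): «Changing the choice of isomorphism `H_L ≅ D` does not change the image of `b` in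
`B(T_{ℚ_p})`» — for `H` a symplectic space with CM by `F` over `ℚ_p`, `D` one over `L` with a `σ`-linear bijection
`Φ` commuting with `F`, and two choices `(ψ, b)`, `(ψ', b')`, the elements `b, b' ∈ T(L)` are `σ`-conjugate under
`T(L)`. [cite: Kottwitz1992, §13 (p. 415)] -/
def Kottwitz1992_13_b_class_independent : Prop :=
  IsLDatum p k Q L σ eL → Literature.AlgebraicGeometry.GaoUllmo2025.IsCMAlgebra F → IsCMInvolution F c →
    IsSymplecticCM F c Q H iH ωH → IsSymplecticCM F c L D iD ωD → Function.Bijective ΦD →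
    (∀ (x : F) (v : D), ΦD (iD x v) = iD x (ΦD v)) →
      ∀ (ψ ψ' : L ⊗[Q] H ≃ₗ[L] D) (b b' : L ⊗[Q] H ≃ₗ[L] L ⊗[Q] H),
        IsBOf Q L σ F H iH ωH D iD ωD ΦD ψ b → IsBOf Q L σ F H iH ωH D iD ωD ΦD ψ' b' →
          SameBClass Q L σ F H iH ωH b b'

variable (K : Type) [Field K] [Algebra ℚ K]

/-- **Lemma 13.1 (named predicate).** «**Lemma 13.1.** The image of `b` in `B(T_{ℚ_p})` is equal to the negative of
the image of `μ ∈ X_*(T_{ℚ_p})` under the canonical isomorphism `X_*(T_{ℚ_p})_Γ ≅ B(T_{ℚ_p})` of [K3].»  The predicate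
records the printed identity for the data `(H, D, Φ, S_A)` and a realisation `fT` of the [K3] map on `T(L)`-valued
representatives (`fT y ∈ T(L)` represents the class `f(y)`): `b` is `σ`-conjugate under `T(L)` to the INVERSE of
`fT(μ)` («negative», `B(T)` written additively).  The paper asserts and proves it (from Lemma 12.1, Shimura–Taniyama
[ST] and the comparison theorem of Fontaine–Messing–Faltings [Fa], pp. 415–416) when `H = H_1(A_{ℚ̄_p}, ℚ_p)`, `D` is
the isocrystal dual to `H¹_cris(A_k/W(k)) ⊗ L` with its Frobenius `Φ`, and `S_A` is the CM type of `Lie(A)`, for an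
abelian variety `A` over `K` with good reduction and CM by `F`; that provenance is not typed (see the module
docstring), so this is a predicate on the data, not a closed fact. [cite: Kottwitz1992, Lemma 13.1 (p. 415)] -/
def Kottwitz1992_13_1_statement (SA : Finset (F →ₐ[ℚ] K))
    (fT : ((F →ₐ[ℚ] K) →₀ ℤ) → (L ⊗[Q] H ≃ₗ[L] L ⊗[Q] H)) (b : L ⊗[Q] H ≃ₗ[L] L ⊗[Q] H) : Prop :=
  SameBClass Q L σ F H iH ωH b (fT (muOf F K SA)).symm

end OverL

/-! ## Over `𝔽̄_p`: the characters `α(v)` and Lemma 13.2 (pp. 416–418) -/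

section Alpha

variable (Γ : Type) [Group Γ] (Y : Type) [AddCommGroup Y] (ρ : Representation ℤ Γ Y)

/-- The coinvariant relations of a subgroup `Δ ≤ Γ` on the cocharacter lattice `Y = X_*(T) = X^*(T̂)`:
`X^*(T̂^Δ) = Y_Δ = Y / ⟨δ y - y⟩` (characters of the diagonalizable group `T̂^Δ`). [cite: Kottwitz1992, §13 (p. 416)] -/
def coinvRel (Δ : Subgroup Γ) : Submodule ℤ Y :=
  Submodule.span ℤ {x : Y | ∃ (δ : Γ) (y : Y), δ ∈ Δ ∧ x = ρ δ y - y}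

/-- **Lemma 13.2 (named predicate).** Setting (p. 416–417): `(A, F → End(A), λ)` a `ℚ`-polarized abelian variety with
CM by `F` over `𝔽̄_p`, `V` a symplectic space with CM by `F` over `ℚ`, `T = Aut(V)`, `T̂` the dual torus with its
`Γ = Gal(ℚ̄/ℚ)`-action, `Γ(v) ↪ Γ` the decomposition groups; «Recall (see [K2, K3]) that there are canonical
isomorphisms (1) `H¹(ℚ_v, T) ≅ X^*(π₀(T̂^{Γ(v)}))` for all `v`, (2) `B(T_{ℚ_p}) ≅ X^*(T̂^{Γ(p)})`»; `α(l)` (`l ≠ p`) is the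
class of `H_1(A, ℚ_l)` relative to `V_{ℚ_l}`, `α(p)` the image of `b`, `α(∞)` the restriction of `μ_h`; «Restrict
each `α(v)` to the subgroup `T̂^Γ` of `T̂^{Γ(v)}` and take the product over all places `v` … this yields a character on
`T̂^Γ` that we will denote by `α`.»  «**Lemma 13.2.** The character `α` on `T̂^Γ` is trivial.»  Typed in lattice form
(`X^*(T̂^Δ) = X_*(T)_Δ`): for a family `α v ∈ Y` of representatives of the `α(v) ∈ Y_{Γ(v)}`, zero for all but
finitely many `v`, the sum `Σ_v α(v)` lies in the `Γ`-coinvariant relations, i.e. the product of the restrictions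
to `T̂^Γ` is the trivial character.  The paper proves it for the `α(v)` arising from `(A, i, λ)` (from Lemma 13.1,
Tate's CM-lifting theorem [T3], Tate–Nakayama duality; pp. 417–418); that provenance is not typed, so this is a
predicate on the data `(Γ, Y, ρ, (α(v))_v)` (`α(v) ∈ Y` representatives of classes in `Y_{Γ(v)}`; restriction to
`T̂^Γ` = passage to `Γ`-coinvariants), not a closed fact. [cite: Kottwitz1992, Lemma 13.2 (p. 417)] -/
def Kottwitz1992_13_2_statement (Pl : Type) (α : Pl → Y) : Prop :=
  ∃ s : Finset Pl, (∀ v : Pl, v ∉ s → α v = 0) ∧ (s.sum fun v => α v) ∈ coinvRel Γ Y ρ ⊤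

end Alpha

/-! ## Discharges (ED. 2, paydown): the cheap printed claims proved from the definitions -/

section Discharges

/-- **Discharge of `Kottwitz1992_13_mu_mem_cocharT`** (p. 415: «Thus the cocharacter `μ := Σ_{s ∈ S_A} s` …
belongs to the subgroup `X_*(T_{ℚ_p})`»): for a CM type `S_A` relative to `K`, exactly one of `s`, `s ∘ *` lies in
`S_A`, so `μ(s) + μ(s ∘ *) = 1` for every `s`, whence `μ ∈ X_*(T_{ℚ_p})`. [cite: Kottwitz1992, §13 (p. 415)] -/
theorem Kottwitz1992_13_mu_mem_cocharT_holds :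
    ∀ (F : Type) [CommRing F] [Algebra ℚ F] (c : F ≃ₐ[ℚ] F) (K : Type) [Field K] [Algebra ℚ K],
      Kottwitz1992_13_mu_mem_cocharT F c K := by
  classical
  intro F _ _ c K _ _ SA hSA
  have key : ∀ u : F →ₐ[ℚ] K, muOf F K SA u + muOf F K SA (u.comp (c : F →ₐ[ℚ] F)) = 1 := by
    intro u
    simp only [muOf, Finsupp.finsetSum_apply, Finsupp.single_apply, Finset.sum_ite_eq']
    by_cases hu : u ∈ SA
    · have hu' : u.comp (c : F →ₐ[ℚ] F) ∉ SA := (hSA u).mp hu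
      simp [hu, hu']
    · have hu' : u.comp (c : F →ₐ[ℚ] F) ∈ SA := by
        by_contra h
        exact hu ((hSA u).mpr h)
      simp [hu, hu']
  simp only [cocharT, Submodule.mem_iInf, LinearMap.mem_ker, LinearMap.sub_apply, LinearMap.add_apply,
    Finsupp.lapply_apply]
  intro s t
  have h1 := key s
  have h2 := key t
  omega

/-- **Discharge of `Kottwitz1992_13_b_class_independent`** (p. 415: «Changing the choice of isomorphism `H_L ≅ D`
does not change the image of `b` in `B(T_{ℚ_p})`»): with `t := ψ'⁻¹ ∘ ψ ∈ T(L)` one has `b' = t b σ(t)⁻¹`.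
[cite: Kottwitz1992, §13 (p. 415)] -/
theorem Kottwitz1992_13_b_class_independent_holds :
    ∀ (p : ℕ) [Fact p.Prime] (k : Type) [Field k] [CharP k p] [IsAlgClosed k] (Q : Type) [Field Q] (L : Type)
      [Field L] [Algebra Q L] (σ : L ≃ₐ[Q] L) (eL : L ≃+* FractionRing (WittVector p k)) (F : Type) [CommRing F]
      [Algebra ℚ F] (c : F ≃ₐ[ℚ] F) (H : Type) [AddCommGroup H] [Module Q H] (iH : F → Module.End Q H)
      (ωH : LinearMap.BilinForm Q H) (D : Type) [AddCommGroup D] [Module L D] (iD : F → Module.End L D)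
      (ωD : LinearMap.BilinForm L D) (ΦD : D →ₛₗ[σ.toAlgHom.toRingHom] D),
      Kottwitz1992_13_b_class_independent p k Q L σ eL F c H iH ωH D iD ωD ΦD := by
  intro p _ k _ _ _ Q _ L _ _ σ eL F _ _ c H _ _ iH ωH D _ _ iD ωD ΦD _ _ _ _ _ _ _ ψ ψ' b b' hb hb'
  obtain ⟨⟨hψF, a, ha, hψω⟩, hb⟩ := hb
  obtain ⟨⟨hψ'F, a', ha', hψ'ω⟩, hb'⟩ := hb'
  refine ⟨ψ.trans ψ'.symm, ⟨fun x v => ?_, a / a', div_ne_zero ha ha', fun v w => ?_⟩, fun v => ?_⟩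
  · simp only [LinearEquiv.trans_apply]
    rw [hψF x v]
    apply ψ'.injective
    rw [LinearEquiv.apply_symm_apply, hψ'F, LinearEquiv.apply_symm_apply]
  · have h1 := hψ'ω (ψ'.symm (ψ v)) (ψ'.symm (ψ w))
    simp only [LinearEquiv.apply_symm_apply] at h1
    have h2 := hψω v w
    simp only [LinearEquiv.trans_apply]
    rw [h2] at h1
    field_simp
    linear_combination h1.symm
  · simp only [LinearEquiv.trans_apply]
    rw [← hb' (ψ'.symm (ψ v)), ← hb v]
    simp only [LinearEquiv.apply_symm_apply]

end Discharges

end Literature.NumberTheory.Kottwitz1992.CMPolarized
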